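import Mathlib
import Summits.CriticalPhenomena.Ising3DConformalLimit.Theses.GaussianScaleMixture
import Literature.Probability.LatticeModels.LroInfraredBoundProofs
import Literature.Probability.LatticeModels.CriticalTwoPointBounds
import Summits.CriticalPhenomena.Ising3DConformalLimit.Theorems.GaussianScaleMixtureCriticalTwoPointGSMGsmClosureOfTight
import Summits.CriticalPhenomena.Ising3DConformalLimit.Theorems.GaussianScaleMixtureCriticalTwoPointGSMExistsExchangeableRepOfRep

/-!
# Subcritical transfer for the crux `CriticalTwoPointGSM` (stmt-CriticalPhenomena-8365)

Route `GaussianScaleMixture` of `Ising3DConformalLimit`, line `Sketch` of the crux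
`CriticalTwoPointGSM` (`Cruxes/CriticalTwoPointGSM/Lines/Sketch.lean`): the line's skeleton with its
only remaining stub, the physical input `subcriticalTightGSM`, moved into the hypothesis — i.e. the
sorry-free TRANSFER THEOREM

  `subcriticalTightGSM ⟹ CriticalTwoPointGSM`:

if along some sequence `βₙ ↑ β_c(3)`, `βₙ < β_c`, the free-state two-point functions
`⟨σ₀σ_x⟩^∅_{βₙ}` on `ℤ³` are Gaussian scale mixtures with probability mixing measures on the
closed octant forming a TIGHT family, then the critical two-point function is a Gaussian scale
mixture with an exchangeable probability mixing measure on the closed octant (the crux, by name).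

Ingredients (all proved in the tree): left-continuity of the free pair function at `β_c`
(`ads_freePair_leftContinuous_holds`, ADS15 §3.3) and `⟨·⟩⁺_{β_c} = ⟨·⟩^∅_{β_c}` on pairs for
`d ≥ 3` (`twoPointPlus_criticalBeta_eq_twoPointFree_holds`, ADS15 Thm 1.2); closure of the
probability-GSM cone under tight pointwise limits (`Theorems.gsmClosure_of_tight`, Prokhorov);
`S₃`-symmetrisation of a representing measure (`Theorems.exists_exchangeable_rep_of_rep`).
This is the glue `SubcriticalTransfer` of the crux idea cards
`subcritical-transfer-tau-midpoint-concavity` / `subcritical-ellipsoid-hull` (and the Transfer `C⁺`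
of `nine-direction-spectral-envelope` / `hartman-watson-lift`), in the weakest form the argument
needs (a sequence, the free state, no exchangeability, tightness explicit).
-/

namespace Summit.CriticalPhenomena.Ising3DConformalLimit.Theorems

open MeasureTheory Filter Topology
open Literature.Probability.LatticeModels
open Summit.CriticalPhenomena.Ising3DConformalLimit.Theses.GaussianScaleMixture (CriticalTwoPointGSM)
open scoped BigOperators

namespace CriticalTwoPointGSMTransfer

/-- Left limit at `β_c`: for every `x ∈ ℤ³`, `⟨σ₀σ_x⟩^∅_β → ⟨σ₀σ_x⟩⁺_{β_c}` as `β ↑ β_c(3)`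
(left-continuity of the free pair function, ADS15 §3.3, `ads_freePair_leftContinuous_holds`, and
`⟨·⟩⁺_{β_c} = ⟨·⟩^∅_{β_c}` on pairs for `d ≥ 3`, `twoPointPlus_criticalBeta_eq_twoPointFree_holds`). -/
theorem twoPointFree_tendsto_criticalTwoPoint (x : Site 3) :
    Tendsto (fun β : ℝ => twoPointFree 3 β x) (𝓝[<] criticalBeta 3) (𝓝 (criticalTwoPoint 3 x)) := by
  have h := ads_freePair_leftContinuous_holds (d := 3) (by norm_num) 0 x
  simp only [freePair_zero_left] at h
  have e : criticalTwoPoint 3 x = twoPointFree 3 (criticalBeta 3) x :=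
    twoPointPlus_criticalBeta_eq_twoPointFree_holds (d := 3) (by norm_num) x
  rw [e]
  exact h

/-- Sequential form of the left limit along any sequence `βₙ < β_c`, `βₙ → β_c`. -/
theorem twoPointFree_seq_tendsto_criticalTwoPoint {β : ℕ → ℝ}
    (hlt : ∀ n, β n < criticalBeta 3) (hlim : Tendsto β atTop (𝓝 (criticalBeta 3))) (x : Site 3) :
    Tendsto (fun n => twoPointFree 3 (β n) x) atTop (𝓝 (criticalTwoPoint 3 x)) :=
  (twoPointFree_tendsto_criticalTwoPoint x).comp
    (tendsto_nhdsWithin_iff.mpr ⟨hlim, Eventually.of_forall fun n => hlt n⟩)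

end CriticalTwoPointGSMTransfer

open CriticalTwoPointGSMTransfer in
/-- **Subcritical transfer.** If there are inverse temperatures `βₙ ∈ [0, β_c(3))` with
`βₙ → β_c(3)` and probability measures `νₙ` on `ℝ³` carried by the closed octant, forming a tight
family, with `⟨σ₀σ_x⟩^∅_{βₙ} = ∫ exp(-∑ᵢ sᵢ xᵢ²) dνₙ(s)` for all `x ∈ ℤ³` and all `n` (the
registered stub `subcriticalTightGSM` of line `Sketch`), then `CriticalTwoPointGSM` holds: by
left-continuity at `β_c` the kernels converge pointwise to `criticalTwoPoint 3`, by
`gsmClosure_of_tight` the limit is represented by a probability measure on the closed octant, and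
`exists_exchangeable_rep_of_rep` symmetrises it. -/
theorem criticalTwoPointGSM_of_subcriticalTightGSM
    (h : ∃ (β : ℕ → ℝ) (ν : ℕ → Measure (Fin 3 → ℝ)),
      (∀ n, 0 ≤ β n ∧ β n < criticalBeta 3) ∧ Tendsto β atTop (𝓝 (criticalBeta 3)) ∧
      (∀ n, IsProbabilityMeasure (ν n)) ∧ (∀ n, (ν n) {s | ∃ i, s i < 0} = 0) ∧
      (∀ n (x : Site 3), twoPointFree 3 (β n) x =
        ∫ s, Real.exp (-∑ i, s i * ((x i : ℝ)) ^ 2) ∂(ν n)) ∧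
      IsTightMeasureSet (Set.range ν)) :
    CriticalTwoPointGSM := by
  obtain ⟨β, ν, hβ, hβlim, hP, hoct, hrep, htight⟩ := h
  have hlim : ∀ x : Site 3,
      Tendsto (fun n => twoPointFree 3 (β n) x) atTop (𝓝 (criticalTwoPoint 3 x)) :=
    twoPointFree_seq_tendsto_criticalTwoPoint (fun n => (hβ n).2) hβlim
  obtain ⟨μ, hμP, hμoct, hμrep⟩ :=
    gsmClosure_of_tight (fun n => twoPointFree 3 (β n)) (criticalTwoPoint 3) ν hP hoct hrep htight hlim
  exact exists_exchangeable_rep_of_rep μ hμP hμoct hμrep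

end Summit.CriticalPhenomena.Ising3DConformalLimit.Theorems
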